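import Summits.Ventures.Crystal3D.Theorems.StickyWulffConstantCoaxialWallLawCellEnds
import Summits.Ventures.Crystal3D.Theorems.StickyWulffConstantCoaxialWallLawInPlaneFrames
import Summits.Ventures.Crystal3D.Theorems.StickyWulffConstantCoaxialWallLawTilt
import HarnessLib

/-!
# The riser count: vacant in-plane slots forced by a wall inclined to the basal plane

HONEST FRAMING. Part of the venture `Summits/Ventures/Crystal3D` (cell `crystal3d-full`), helper
`--supports` the crux `CoaxialWallLaw` (stmt-Ventures-19481, `route-Ventures-StickyWulffConstant`),
REGISTERED line `WallLedgerF` (planner cf-p1 gen 16), stub `stub_coaxialTwoSlabAdhesion`.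
Composition of this seat's chain `…Tilt` + `…InPlaneFrames` + `…CellEnds` (+ `…ForcedEnds`,
`…RunEnds`, `…BlockedWindow`, 19480-p1's `lineCount_offset_window`).

**Theorem (`inPlane_vacancies_ge_sine`).**  In the clamped wall cell of the stub (unit packing
`X` containing the complete slabs of grain 1 `= A·Λ₀ + t` in `[−2R₀, −R₀]` and of grain 2
`= A₂·Λ₀ + t₂` in `[h + R₀, h + 2R₀]`, disc radius `ρ ≥ R₀ ≥ 3`, the two grains disjoint as point
sets), the six directed IN-PLANE slots `±A u, ±A v, ±A(u − v)` of grain 1 (basal plane of the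
grain's own Barlow frame) satisfy

  `√6 · √(1 − ⟪A e₃, e₃⟫²) · π ρ² − 3√2 π (6R₀ + 16)(1 + h) ρ ≤ Σ_{w} #{x ∈ X ∩ grain 1 : x + w ∉ X}`,

i.e. a wall whose normal `e₃` makes angle `θ` with the grain's basal axis `A e₃` forces at least
`√6 sin θ · π ρ² − C(1+h)ρ` vacant in-plane slots on the balls of grain 1 (and symmetrically on
grain 2).  By the two-grain ledger (`…TwoGrainLedger`, `2D = Σ (vacant − foreign contacts)`) the
crux's `½ sin θ · πρ²` therefore follows from the ABSORPTION INEQUALITY «each foreign contact is paid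
by one out-of-plane or two in-plane vacancies» (landed for one and two foreign partners:
`…SingleVacancy`, `…DoubleVacancy`, `…Ribbon`; open for three), with margin `2√6 · ¼ / ½ = 2.45`.
For the stub the frame must be the SHARED one (`L e₃ = ±A e₃` after re-choosing `A` by a lattice
symmetry; for translation pairs the axis adapted to the shift — this seat's evidence
RISER-LEDGER-FINDINGS.md); that normalisation is not in this file.
WHAT THIS IS NOT: the absorption inequality, coincidence sites, the frame normalisation; the stub;
rung F-C1 not moved.
-/

noncomputable section

namespace Summit.Ventures.Crystal3D.Theorems

open Summit.Ventures.Crystal3D Finset Matrix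
open Literature.MathematicalPhysics.StatisticalMechanics (barlowPos fccStacking constHagg
  triangularVec₁ triangularVec₂)
open scoped InnerProductSpace

/-- Negating the third vector of a frame keeps `det²`. -/
theorem det_sq_neg_third (Ea Eb W : EuclideanSpace ℝ (Fin 3)) :
    (Matrix.det ![WithLp.ofLp Ea, WithLp.ofLp Eb, WithLp.ofLp (-W)]) ^ 2 =
      (Matrix.det ![WithLp.ofLp Ea, WithLp.ofLp Eb, WithLp.ofLp W]) ^ 2 := by
  have h : Matrix.det ![WithLp.ofLp Ea, WithLp.ofLp Eb, WithLp.ofLp (-W)] =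
      -Matrix.det ![WithLp.ofLp Ea, WithLp.ofLp Eb, WithLp.ofLp W] := by
    rw [Matrix.det_fin_three, Matrix.det_fin_three]
    simp
    ring
  rw [h, neg_sq]

/-- **One in-plane class, both directions.**  Under the hypotheses of `forced_vacantSlots_cell`
except the sign of `α = ⟪A W, e₃⟫`:
`√2 |α| π ρ² − √2 π (6R₀+16)(1+h) ρ ≤ #{x : x + A W ∉ X} + #{x : x − A W ∉ X}`. -/
theorem forced_vacantSlots_cell_abs
    (A : EuclideanSpace ℝ (Fin 3) ≃ₗᵢ[ℝ] EuclideanSpace ℝ (Fin 3)) (t : EuclideanSpace ℝ (Fin 3))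
    [DecidablePred fun p : EuclideanSpace ℝ (Fin 3) =>
      p ∈ (fun q => A q + t) '' fccStacking 1 (Real.sqrt (2 / 3))]
    (A₂ : EuclideanSpace ℝ (Fin 3) ≃ₗᵢ[ℝ] EuclideanSpace ℝ (Fin 3)) (t₂ : EuclideanSpace ℝ (Fin 3))
    (X : Finset (EuclideanSpace ℝ (Fin 3)))
    (hX : ∀ p ∈ X, ∀ q ∈ X, p ≠ q → 1 ≤ dist p q)
    (R₀ h ρ : ℝ) (hR₀ : 3 ≤ R₀) (hh : 0 ≤ h) (hρ : R₀ ≤ ρ)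
    (hP₁ : ∀ p ∈ (fun q => A q + t) '' fccStacking 1 (Real.sqrt (2 / 3)),
      -(2 * R₀) ≤ p 2 → p 2 ≤ -R₀ → p 0 ^ 2 + p 1 ^ 2 ≤ ρ ^ 2 → p ∈ X)
    (hP₂ : ∀ p ∈ (fun q => A₂ q + t₂) '' fccStacking 1 (Real.sqrt (2 / 3)),
      h + R₀ ≤ p 2 → p 2 ≤ h + 2 * R₀ → p 0 ^ 2 + p 1 ^ 2 ≤ ρ ^ 2 → p ∈ X)
    (hdisj : ∀ p ∈ (fun q => A q + t) '' fccStacking 1 (Real.sqrt (2 / 3)),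
      p ∉ (fun q => A₂ q + t₂) '' fccStacking 1 (Real.sqrt (2 / 3)))
    (Ea Eb W : EuclideanSpace ℝ (Fin 3)) (hEa : ‖Ea‖ ≤ 1) (hEb : ‖Eb‖ ≤ 1) (hW : ‖W‖ = 1)
    (hdet : (Matrix.det ![WithLp.ofLp Ea, WithLp.ofLp Eb, WithLp.ofLp W]) ^ 2 = 1 / 2)
    (hframe : ∀ a b τ : ℤ,
      (a : ℝ) • Ea + (b : ℝ) • Eb + (τ : ℝ) • W ∈ fccStacking 1 (Real.sqrt (2 / 3)))
    (hspan : ∀ q ∈ fccStacking 1 (Real.sqrt (2 / 3)), ∃ a b τ : ℤ,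
      q = (a : ℝ) • Ea + (b : ℝ) • Eb + (τ : ℝ) • W) :
    Real.sqrt 2 * |⟪A W, EuclideanSpace.single (2 : Fin 3) (1 : ℝ)⟫_ℝ| * Real.pi * ρ ^ 2 -
        Real.sqrt 2 * Real.pi * (6 * R₀ + 16) * (1 + h) * ρ ≤
      (((X.filter fun p => p ∈ (fun q => A q + t) '' fccStacking 1 (Real.sqrt (2 / 3))).filter
          fun p => p + A W ∉ X).card : ℝ) +
      (((X.filter fun p => p ∈ (fun q => A q + t) '' fccStacking 1 (Real.sqrt (2 / 3))).filter
          fun p => p - A W ∉ X).card : ℝ) := by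
  set α : ℝ := ⟪A W, EuclideanSpace.single (2 : Fin 3) (1 : ℝ)⟫_ℝ with hα
  have hρ0 : 0 ≤ ρ := by linarith
  have hC0 : 0 ≤ Real.sqrt 2 * Real.pi * (6 * R₀ + 16) * (1 + h) * ρ := by
    have : 0 ≤ 6 * R₀ + 16 := by linarith
    positivity
  have hc1 : (0 : ℝ) ≤ (((X.filter fun p => p ∈ (fun q => A q + t) '' fccStacking 1 (Real.sqrt (2 / 3))).filter
      fun p => p + A W ∉ X).card : ℝ) := Nat.cast_nonneg _
  have hc2 : (0 : ℝ) ≤ (((X.filter fun p => p ∈ (fun q => A q + t) '' fccStacking 1 (Real.sqrt (2 / 3))).filter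
      fun p => p - A W ∉ X).card : ℝ) := Nat.cast_nonneg _
  rcases lt_trichotomy 0 α with hpos | hzero | hneg
  · have key := forced_vacantSlots_cell A t A₂ t₂ X hX R₀ h ρ hR₀ hh hρ hP₁ hP₂ hdisj Ea Eb W hEa hEb
      hW hdet hframe hspan hpos
    rw [abs_of_pos hpos]
    linarith
  · rw [← hzero, abs_zero, mul_zero, zero_mul, zero_mul, zero_sub]
    linarith
  · -- use the frame `(Ea, Eb, −W)`
    have hW' : ‖-W‖ = 1 := by rw [norm_neg, hW]
    have hdet' := (det_sq_neg_third Ea Eb W).trans hdet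
    have hframe' : ∀ a b τ : ℤ,
        (a : ℝ) • Ea + (b : ℝ) • Eb + (τ : ℝ) • (-W) ∈ fccStacking 1 (Real.sqrt (2 / 3)) := by
      intro a b τ
      have := hframe a b (-τ)
      rw [Int.cast_neg, neg_smul] at this
      rwa [smul_neg]
    have hspan' : ∀ q ∈ fccStacking 1 (Real.sqrt (2 / 3)), ∃ a b τ : ℤ,
        q = (a : ℝ) • Ea + (b : ℝ) • Eb + (τ : ℝ) • (-W) := by
      intro q hq
      obtain ⟨a, b, τ, rfl⟩ := hspan q hq
      refine ⟨a, b, -τ, ?_⟩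
      rw [Int.cast_neg, neg_smul, smul_neg, neg_neg]
    have hpos' : 0 < ⟪A (-W), EuclideanSpace.single (2 : Fin 3) (1 : ℝ)⟫_ℝ := by
      rw [map_neg, inner_neg_left]; linarith
    have key := forced_vacantSlots_cell A t A₂ t₂ X hX R₀ h ρ hR₀ hh hρ hP₁ hP₂ hdisj Ea Eb (-W)
      hEa hEb hW' hdet' hframe' hspan' hpos'
    rw [map_neg, inner_neg_left] at key
    have e : ((X.filter fun p => p ∈ (fun q => A q + t) '' fccStacking 1 (Real.sqrt (2 / 3))).filter
        fun p => p + -A W ∉ X) =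
        ((X.filter fun p => p ∈ (fun q => A q + t) '' fccStacking 1 (Real.sqrt (2 / 3))).filter
        fun p => p - A W ∉ X) := by simp only [sub_eq_add_neg]
    rw [e] at key
    rw [abs_of_neg hneg]
    linarith

/-- **The riser count.**  See the module docstring: the six directed in-plane slots of grain 1
carry at least `√6 · √(1 − ⟪A e₃, e₃⟫²) · π ρ² − 3√2 π (6R₀ + 16)(1 + h) ρ` vacancies. -/
theorem inPlane_vacancies_ge_sine
    (A : EuclideanSpace ℝ (Fin 3) ≃ₗᵢ[ℝ] EuclideanSpace ℝ (Fin 3)) (t : EuclideanSpace ℝ (Fin 3))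
    [DecidablePred fun p : EuclideanSpace ℝ (Fin 3) =>
      p ∈ (fun q => A q + t) '' fccStacking 1 (Real.sqrt (2 / 3))]
    (A₂ : EuclideanSpace ℝ (Fin 3) ≃ₗᵢ[ℝ] EuclideanSpace ℝ (Fin 3)) (t₂ : EuclideanSpace ℝ (Fin 3))
    (X : Finset (EuclideanSpace ℝ (Fin 3)))
    (hX : ∀ p ∈ X, ∀ q ∈ X, p ≠ q → 1 ≤ dist p q)
    (R₀ h ρ : ℝ) (hR₀ : 3 ≤ R₀) (hh : 0 ≤ h) (hρ : R₀ ≤ ρ)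
    (hP₁ : ∀ p ∈ (fun q => A q + t) '' fccStacking 1 (Real.sqrt (2 / 3)),
      -(2 * R₀) ≤ p 2 → p 2 ≤ -R₀ → p 0 ^ 2 + p 1 ^ 2 ≤ ρ ^ 2 → p ∈ X)
    (hP₂ : ∀ p ∈ (fun q => A₂ q + t₂) '' fccStacking 1 (Real.sqrt (2 / 3)),
      h + R₀ ≤ p 2 → p 2 ≤ h + 2 * R₀ → p 0 ^ 2 + p 1 ^ 2 ≤ ρ ^ 2 → p ∈ X)
    (hdisj : ∀ p ∈ (fun q => A q + t) '' fccStacking 1 (Real.sqrt (2 / 3)),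
      p ∉ (fun q => A₂ q + t₂) '' fccStacking 1 (Real.sqrt (2 / 3))) :
    Real.sqrt 6 * Real.sqrt (1 - ⟪A (EuclideanSpace.single (2 : Fin 3) (1 : ℝ)),
        EuclideanSpace.single (2 : Fin 3) (1 : ℝ)⟫_ℝ ^ 2) * Real.pi * ρ ^ 2 -
        3 * (Real.sqrt 2 * Real.pi * (6 * R₀ + 16) * (1 + h) * ρ) ≤
      (((X.filter fun p => p ∈ (fun q => A q + t) '' fccStacking 1 (Real.sqrt (2 / 3))).filter
          fun p => p + A (triangularVec₁ 1) ∉ X).card : ℝ) +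
      (((X.filter fun p => p ∈ (fun q => A q + t) '' fccStacking 1 (Real.sqrt (2 / 3))).filter
          fun p => p - A (triangularVec₁ 1) ∉ X).card : ℝ) +
      (((X.filter fun p => p ∈ (fun q => A q + t) '' fccStacking 1 (Real.sqrt (2 / 3))).filter
          fun p => p + A (triangularVec₂ 1) ∉ X).card : ℝ) +
      (((X.filter fun p => p ∈ (fun q => A q + t) '' fccStacking 1 (Real.sqrt (2 / 3))).filter
          fun p => p - A (triangularVec₂ 1) ∉ X).card : ℝ) +
      (((X.filter fun p => p ∈ (fun q => A q + t) '' fccStacking 1 (Real.sqrt (2 / 3))).filter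
          fun p => p + A (triangularVec₂ 1 - triangularVec₁ 1) ∉ X).card : ℝ) +
      (((X.filter fun p => p ∈ (fun q => A q + t) '' fccStacking 1 (Real.sqrt (2 / 3))).filter
          fun p => p - A (triangularVec₂ 1 - triangularVec₁ 1) ∉ X).card : ℝ) := by
  obtain ⟨hu_eq, hv_eq⟩ := inPlane_generators_eq
  -- class `u`
  obtain ⟨h1, h2, h3, h4, h5, h6⟩ := inPlaneFrame_u
  have cu := forced_vacantSlots_cell_abs A t A₂ t₂ X hX R₀ h ρ hR₀ hh hρ hP₁ hP₂ hdisj _ _ _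
    h1 h2 h3 h4 h5 h6
  rw [hu_eq] at cu
  -- class `v`
  obtain ⟨h1, h2, h3, h4, h5, h6⟩ := inPlaneFrame_v
  have cv := forced_vacantSlots_cell_abs A t A₂ t₂ X hX R₀ h ρ hR₀ hh hρ hP₁ hP₂ hdisj _ _ _
    h1 h2 h3 h4 h5 h6
  rw [hv_eq] at cv
  -- class `u − v`
  obtain ⟨h1, h2, h3, h4, h5, h6⟩ := inPlaneFrame_uv
  have cuv := forced_vacantSlots_cell_abs A t A₂ t₂ X hX R₀ h ρ hR₀ hh hρ hP₁ hP₂ hdisj _ _ _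
    h1 h2 h3 h4 h5 h6
  have huv : barlowPos 1 (Real.sqrt (2 / 3)) constHagg 0 1 (-1) = triangularVec₁ 1 - triangularVec₂ 1 := by
    rw [← hu_eq, ← hv_eq, ← fcc_bond_differences.1]
  rw [huv] at cuv
  -- `u − v = −(v − u)`: swap the two directed counts and the sign inside `|·|`
  have e1 : A (triangularVec₁ 1 - triangularVec₂ 1) = -A (triangularVec₂ 1 - triangularVec₁ 1) := by
    rw [← map_neg, neg_sub]
  rw [e1, inner_neg_left, abs_neg] at cuv
  have e2 : ((X.filter fun p => p ∈ (fun q => A q + t) '' fccStacking 1 (Real.sqrt (2 / 3))).filter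
      fun p => p + -A (triangularVec₂ 1 - triangularVec₁ 1) ∉ X) =
      ((X.filter fun p => p ∈ (fun q => A q + t) '' fccStacking 1 (Real.sqrt (2 / 3))).filter
      fun p => p - A (triangularVec₂ 1 - triangularVec₁ 1) ∉ X) := by simp only [sub_eq_add_neg]
  have e3 : ((X.filter fun p => p ∈ (fun q => A q + t) '' fccStacking 1 (Real.sqrt (2 / 3))).filter
      fun p => p - -A (triangularVec₂ 1 - triangularVec₁ 1) ∉ X) =
      ((X.filter fun p => p ∈ (fun q => A q + t) '' fccStacking 1 (Real.sqrt (2 / 3))).filter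
      fun p => p + A (triangularVec₂ 1 - triangularVec₁ 1) ∉ X) := by simp only [sub_neg_eq_add]
  rw [e2, e3] at cuv
  -- the tilt inequality
  have htilt := coaxial_sine_le_inPlaneClasses A
  have hπρ : 0 ≤ Real.pi * ρ ^ 2 := by positivity
  have hmul := mul_le_mul_of_nonneg_right htilt hπρ
  nlinarith [cu, cv, cuv, hmul]

end Summit.Ventures.Crystal3D.Theorems

end
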